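import Mathlib.AlgebraicGeometry.AffineSpace
import Mathlib.AlgebraicGeometry.Morphisms.Immersion
import Mathlib.AlgebraicGeometry.Morphisms.FiniteType
import HarnessLib

/-!
# An affine scheme of finite type over `S` immerses into affine space over `S` (Stacks 04II)

Topic: `Literature/AlgebraicGeometry/Morphisms`. Stacks, Tag 04II (Morphisms, Lemma 29.39.2):
"Let `π : X → S` be a morphism of schemes. Assume that `X` is quasi-affine and that `π` is
locally of finite type. Then there exist `n ≥ 0` and an immersion `i : X → 𝐀ⁿ_S` over `S`."
This file proves the case of an AFFINE `X` (the case used in the proof of Raynaud–Gruson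
flattening, Stacks 081R, ¶2: "we may assume `X` is affine … choose an immersion `X → 𝐀ⁿ_S`"),
following the printed proof: with `A = Γ(X, 𝒪_X)`, choose finitely many `fⱼ ∈ A` with
`X = ⋃ X_{fⱼ}` and `π(X_{fⱼ}) ⊆ Vⱼ` affine; the ring maps `𝒪(Vⱼ) → A_{fⱼ}` are of finite type;
choose `a₁, …, a_N ∈ A` such that the `aₖ/1` and `1/fⱼ` generate `A_{fⱼ}` over `𝒪(Vⱼ)`; the
morphism `i : X → 𝐀ⁿ_S` given by the global sections `fⱼ, aₖ` restricts, over the affine opens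
`D(xⱼ) ∩ 𝐀ⁿ_{Vⱼ}`, to closed immersions `X_{fⱼ} → D(xⱼ) ∩ 𝐀ⁿ_{Vⱼ}` (the ring map is
surjective), hence is an immersion.

* `isImmersion_of_affine_cover` — a morphism is an immersion as soon as, over the members `Wⱼ`
  of a family of affine opens of the target containing its image, it has affine preimages and
  surjective maps on sections `Γ(Wⱼ) → Γ(i⁻¹Wⱼ)`;
* `exists_isImmersion_comp_eq_of_isAffine` — **Stacks 04II for `X` affine** (for an affine
  base and `X = Spec B` the tree already has the closed immersion `Spec B → 𝐀^ι_{Spec A}`,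
  `Literature.AlgebraicGeometry.Morphisms.exists_isClosedImmersion_affineSpace`).

## References

* The Stacks Project, Tag 04II (`morphisms-lemma-quasi-affine-finite-type-over-S`), with
  Tag 01T2 (finite type is local) and Tag 01P9. [StacksProject]
-/

noncomputable section

open CategoryTheory CategoryTheory.Limits AlgebraicGeometry TopologicalSpace

namespace Literature.AlgebraicGeometry.Morphisms

universe u

/-! ## Immersions from a cover of the target by affine charts -/

section Cover

variable {X Y : Scheme.{u}} (i : X ⟶ Y)

/-- Surjectivity of `f.app O` is invariant under equality of the open `O`. [folklore] -/
theorem surjective_app_congr {O₁ O₂ : Y.Opens} (e : O₁ = O₂) :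
    Function.Surjective (i.app O₁) ↔ Function.Surjective (i.app O₂) := by
  subst e
  exact Iff.rfl

/-- Composing a surjective ring map with an isomorphism on the right stays surjective.
[folklore] -/
theorem surjective_comp_of_isIso_right {A B C : CommRingCat.{u}} (f : A ⟶ B) (e : B ⟶ C)
    [IsIso e] (h : Function.Surjective f) : Function.Surjective (f ≫ e) := by
  intro c
  obtain ⟨b, rfl⟩ := (ConcreteCategory.bijective_of_isIso e).2 c
  obtain ⟨a, rfl⟩ := h b
  exact ⟨a, rfl⟩

/-- Composing a surjective ring map with an `eqToHom` on the right stays surjective. [folklore] -/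
theorem surjective_comp_eqToHom {A B C : CommRingCat.{u}} (f : A ⟶ B) (h : B = C)
    (hf : Function.Surjective f) : Function.Surjective (f ≫ eqToHom h) := by
  subst h
  simpa using hf

/-- Composing a surjective ring map with an isomorphism on the left stays surjective.
[folklore] -/
theorem surjective_comp_of_isIso_left {A B C : CommRingCat.{u}} (e : A ⟶ B) (f : B ⟶ C)
    [IsIso e] (h : Function.Surjective f) : Function.Surjective (e ≫ f) := by
  intro c
  obtain ⟨b, rfl⟩ := h c
  obtain ⟨a, rfl⟩ := (ConcreteCategory.bijective_of_isIso e).2 b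
  exact ⟨a, rfl⟩

/-- **An immersion criterion from affine charts of the target.** Let `i : X → Y` and `Wⱼ ⊆ Y`
affine opens containing the image of `i`, with affine preimages `i⁻¹Wⱼ`, such that the maps on
sections `Γ(Y, Wⱼ) → Γ(X, i⁻¹Wⱼ)` are surjective. Then `i` is an immersion: it factors through
the open `W = ⋃ Wⱼ` by a morphism which is a closed immersion over each `Wⱼ` (a morphism of
affine schemes surjective on global sections), hence a closed immersion (closed immersions are
Zariski-local on the target). [cite: StacksProject, Tag 04II (proof)] -/
theorem isImmersion_of_affine_cover {J : Type*} (W : J → Y.Opens) (hWa : ∀ j, IsAffineOpen (W j))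
    (hXa : ∀ j, IsAffineOpen (i ⁻¹ᵁ W j)) (hrange : Set.range i ⊆ ⋃ j, (W j : Set Y))
    (hsurj : ∀ j, Function.Surjective (i.app (W j))) : IsImmersion i := by
  -- the open `⨆ W j` and the lift of `i` into it
  have hrange' : Set.range i ⊆ Set.range (⨆ j, W j).ι := by
    rw [Scheme.Opens.range_ι, Opens.coe_iSup]
    exact hrange
  let iW := IsOpenImmersion.lift (⨆ j, W j).ι i hrange'
  have hfac : iW ≫ (⨆ j, W j).ι = i := IsOpenImmersion.lift_fac _ _ _
  -- `iW` is a closed immersion, locally over the `W j`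
  haveI : IsClosedImmersion iW := by
    refine IsZariskiLocalAtTarget.of_iSup_eq_top (fun j => (⨆ j, W j).ι ⁻¹ᵁ W j) ?_ fun j => ?_
    · refine top_le_iff.mp ?_
      rw [← Scheme.Opens.ι_preimage_self (U := ⨆ j, W j), Scheme.Hom.preimage_iSup]
    · have hle : W j ≤ ⨆ j, W j := le_iSup W j
      haveI : IsAffine (((⨆ j, W j).ι ⁻¹ᵁ W j : (⨆ j, W j : Y.Opens).toScheme.Opens) : Scheme.{u}) :=
        (hWa j).preimage_of_isOpenImmersion (⨆ j, W j).ι (by rwa [Scheme.Opens.opensRange_ι])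
      haveI : IsAffine ((iW ⁻¹ᵁ ((⨆ j, W j).ι ⁻¹ᵁ W j) : X.Opens) : Scheme.{u}) := by
        have e : iW ⁻¹ᵁ ((⨆ j, W j).ι ⁻¹ᵁ W j) = i ⁻¹ᵁ W j := by
          rw [← Scheme.Hom.comp_preimage, hfac]
        rw [e]
        exact hXa j
      refine IsClosedImmersion.of_surjective_of_isAffine _ ?_
      rw [morphismRestrict_appTop, IsOpenImmersion.lift_app]
      simp only [eqToHom_op, eqToHom_map, Category.assoc, eqToHom_trans]
      apply surjective_comp_of_isIso_left
      apply surjective_comp_eqToHom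
      have e : (⨆ j, W j).ι ''ᵁ (((⨆ j, W j).ι ⁻¹ᵁ W j).ι ''ᵁ ⊤) = W j := by
        rw [Scheme.Hom.image_top_eq_opensRange, Scheme.Opens.opensRange_ι,
          Scheme.Hom.image_preimage_eq_opensRange_inf, Scheme.Opens.opensRange_ι, inf_eq_right.mpr hle]
      exact (surjective_app_congr i e).mpr (hsurj j)
  rw [← hfac]
  exact IsImmersion.isImmersion_iff_exists.mpr ⟨_, iW, (⨆ j, W j).ι, inferInstance, inferInstance, rfl⟩

end Cover

/-! ## Generation of a ring by a subring image, numerators and an inverse -/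

section Algebra

/-- A ring map of finite type: the target is generated, as a ring, by the image and a finite
set. [folklore] -/
theorem exists_finset_closure_eq_top_of_finiteType {R A : Type*} [CommRing R] [CommRing A]
    {φ : R →+* A} (hφ : φ.FiniteType) :
    ∃ s : Finset A, Subring.closure (Set.range φ ∪ (s : Set A)) = ⊤ := by
  letI := φ.toAlgebra
  have hft : Algebra.FiniteType R A := hφ
  obtain ⟨s, hs⟩ := hft.out
  refine ⟨s, ?_⟩
  rw [show φ = algebraMap R A from rfl, ← Algebra.adjoin_eq_ring_closure, hs, Algebra.top_toSubring]

/-- **Surjectivity of a ring map onto a localisation `B = A[1/f]` from generators**: if the range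
of `ψ : T → B` contains the range of `φ : R → B`, the images `a/1` of the numerators of a
finite family `s` of elements of `B` generating `B` over `φ(R)`, and an inverse of `f/1`, then
`ψ` is surjective (each generator is `(a/1) · (1/f)ᵐ`). [folklore] -/
theorem surjective_of_generators {R A B T : Type*} [CommRing R] [CommRing A] [CommRing B]
    [CommRing T] [Algebra A B] (f : A) [IsLocalization.Away f B] (φ : R →+* B) (ψ : T →+* B)
    (s : Finset B) (hs : Subring.closure (Set.range φ ∪ (s : Set B)) = ⊤)
    (hφ : ∀ r, φ r ∈ ψ.range) (w : T) (hw : ψ w * algebraMap A B f = 1)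
    (hnum : ∀ y ∈ s, ∃ (m : ℕ) (t : T), y * algebraMap A B (f ^ m) = ψ t) :
    Function.Surjective ψ := by
  rw [← RingHom.range_eq_top, eq_top_iff, ← hs]
  refine Subring.closure_le.mpr ?_
  rintro y (⟨r, rfl⟩ | hy)
  · exact hφ r
  · obtain ⟨m, t, ht⟩ := hnum y hy
    have : y = ψ (t * w ^ m) := by
      rw [map_mul, map_pow, ← ht, mul_assoc, map_pow, ← mul_pow, mul_comm (algebraMap A B f), hw,
        one_pow, mul_one]
    rw [this]
    exact ⟨_, rfl⟩

end Algebra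

/-! ## Stacks 04II for an affine source -/

section AffineSource

variable {X S : Scheme.{u}} (π : X ⟶ S) [IsAffine X] [LocallyOfFiniteType π]

omit [LocallyOfFiniteType π] in
/-- **Charts**: finitely many basic opens `D(fⱼ)` covering the affine `X`, each mapping into an
affine open `Vⱼ` of `S`. [cite: StacksProject, Tag 04II (proof)] -/
theorem exists_basicOpen_charts : ∃ (J : Type u) (_ : Finite J) (f : J → Γ(X, ⊤)) (V : J → S.affineOpens),
    (⨆ j, X.basicOpen (f j)) = ⊤ ∧ ∀ j, X.basicOpen (f j) ≤ π ⁻¹ᵁ (V j : S.Opens) := by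
  classical
  have hx : ∀ x : X, ∃ (f : Γ(X, ⊤)) (V : S.affineOpens),
      x ∈ X.basicOpen f ∧ X.basicOpen f ≤ π ⁻¹ᵁ (V : S.Opens) := fun x => by
    obtain ⟨V, hV, hxV, -⟩ :=
      exists_isAffineOpen_mem_and_subset (X := S) (x := π x) (U := ⊤) (Opens.mem_top _)
    obtain ⟨f, hfV, hxf⟩ :=
      (isAffineOpen_top X).exists_basicOpen_le (V := π ⁻¹ᵁ V) ⟨x, hxV⟩ (Opens.mem_top _)
    exact ⟨f, ⟨V, hV⟩, hxf, hfV⟩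
  choose f V hxf hfV using hx
  obtain ⟨t, ht⟩ := isCompact_univ.elim_finite_subcover (fun x : X => (X.basicOpen (f x) : Set X))
    (fun x => (X.basicOpen (f x)).2) (fun x _ => Set.mem_iUnion.mpr ⟨x, hxf x⟩)
  refine ⟨t, inferInstance, fun x => f x, fun x => V x, ?_, fun x => hfV x⟩
  refine top_le_iff.mp fun x _ => ?_
  obtain ⟨y, hy, hxy⟩ := Set.mem_iUnion₂.mp (ht (Set.mem_univ x))
  exact Opens.mem_iSup.mpr ⟨⟨y, hy⟩, hxy⟩

/-- The ring map `𝒪(V) → Γ(X, D(f)) = A[1/f]` of a chart is of finite type, hence `A[1/f]` is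
generated over `𝒪(V)` by finitely many elements; their numerators. [cite: StacksProject, Tag 04II (proof)] -/
theorem exists_numerators (V : S.affineOpens) (f : Γ(X, ⊤))
    (h : X.basicOpen f ≤ π ⁻¹ᵁ (V : S.Opens)) :
    ∃ (s : Finset Γ(X, X.basicOpen f)) (num : Γ(X, X.basicOpen f) → Γ(X, ⊤)) (ex : Γ(X, X.basicOpen f) → ℕ),
      Subring.closure (Set.range (π.appLE V (X.basicOpen f) h) ∪ (s : Set _)) = ⊤ ∧
      ∀ y, y * algebraMap Γ(X, ⊤) Γ(X, X.basicOpen f) (f ^ ex y) = algebraMap Γ(X, ⊤) _ (num y) := by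
  haveI := (isAffineOpen_top X).isLocalization_basicOpen f
  have hft : (π.appLE V (X.basicOpen f) h).hom.FiniteType :=
    HasRingHomProperty.appLE @LocallyOfFiniteType π inferInstance V
      ⟨X.basicOpen f, (isAffineOpen_top X).basicOpen f⟩ h
  obtain ⟨s, hs⟩ := exists_finset_closure_eq_top_of_finiteType hft
  have hnum : ∀ y : Γ(X, X.basicOpen f), ∃ me : ℕ × Γ(X, ⊤),
      y * algebraMap Γ(X, ⊤) _ (f ^ me.1) = algebraMap Γ(X, ⊤) _ me.2 := fun y => by
    obtain ⟨⟨a, _, m, rfl⟩, e⟩ := IsLocalization.surj (.powers f) y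
    exact ⟨(m, a), e⟩
  choose me hme using hnum
  exact ⟨s, fun y => (me y).2, fun y => (me y).1, hs, hme⟩

/-- **Stacks, Tag 04II, for an affine source**: a morphism `π : X → S` locally of finite type
with `X` affine factors as an immersion `i : X → 𝐀^ι_S` into an affine space over `S` (finite
`ι`) followed by the projection. Printed statement (Morphisms, Lemma 29.39.2): "Let `π : X → S`
be a morphism of schemes. Assume that `X` is quasi-affine and that `π` is locally of finite
type. Then there exist `n ≥ 0` and an immersion `i : X → 𝐀ⁿ_S` over `S`"; here `X` affine
(the quasi-affine case adds the embedding `X ⊆ Spec Γ(X, 𝒪_X)`, Stacks 01P9, and is not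
treated). Proof as printed: charts `D(fⱼ) → Vⱼ` (`exists_basicOpen_charts`), finite type of
`𝒪(Vⱼ) → A_{fⱼ}` and numerators of generators (`exists_numerators`), `i` given by the global
sections `fⱼ` and the numerators (`AffineSpace.homOfVector`), and over the affine opens
`D(xⱼ) ∩ 𝐀^ι_{Vⱼ}` the maps on sections are surjective (`surjective_of_generators`), so that
`isImmersion_of_affine_cover` applies. [cite: StacksProject, Tag 04II] -/
theorem exists_isImmersion_comp_eq_of_isAffine :
    ∃ (ι : Type u) (_ : Finite ι) (i : X ⟶ 𝔸(ι; S)), IsImmersion i ∧ i ≫ (𝔸(ι; S) ↘ S) = π := by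
  classical
  obtain ⟨J, _, f, V, hcov, hfV⟩ := exists_basicOpen_charts π
  choose s num ex hs hnum using fun j => exists_numerators π (V j) (f j) (hfV j)
  haveI : ∀ j, IsLocalization.Away (f j) Γ(X, X.basicOpen (f j)) := fun j =>
    (isAffineOpen_top X).isLocalization_basicOpen (f j)
  -- coordinates: the `f j` and the numerators of the generators
  obtain ⟨v, hv⟩ : ∃ v : (J ⊕ Σ j, ↥(s j)) → Γ(X, ⊤), v = Sum.elim f (fun p => num p.1 p.2) :=
    ⟨_, rfl⟩
  obtain ⟨i, hi⟩ : ∃ i : X ⟶ 𝔸(J ⊕ Σ j, ↥(s j); S), i = AffineSpace.homOfVector π v := ⟨_, rfl⟩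
  have hiπ : i ≫ (𝔸(J ⊕ Σ j, ↥(s j); S) ↘ S) = π := by
    rw [hi]
    exact AffineSpace.homOfVector_over π v
  have hiv : ∀ k, i.appTop (AffineSpace.coord S k) = v k := fun k => by
    rw [hi]
    exact AffineSpace.homOfVector_appTop_coord π v k
  refine ⟨J ⊕ Σ j, ↥(s j), inferInstance, i, ?_, hiπ⟩
  -- the affine charts `W j = D(x_j) ∩ 𝐀_{V j}` of the affine space
  have hA : ∀ j, IsAffineOpen ((𝔸(J ⊕ Σ j, ↥(s j); S) ↘ S) ⁻¹ᵁ (V j : S.Opens)) := fun j =>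
    (V j).2.preimage _
  -- the restricted coordinate `x_j|` and the chart
  let c : ∀ j, Γ(𝔸(J ⊕ Σ j, ↥(s j); S), (𝔸(J ⊕ Σ j, ↥(s j); S) ↘ S) ⁻¹ᵁ (V j : S.Opens)) := fun j =>
    (𝔸(J ⊕ Σ j, ↥(s j); S)).presheaf.map (homOfLE le_top).op (AffineSpace.coord S (Sum.inl j))
  let W : J → (𝔸(J ⊕ Σ j, ↥(s j); S)).Opens := fun j => (𝔸(J ⊕ Σ j, ↥(s j); S)).basicOpen (c j)
  have hWa : ∀ j, IsAffineOpen (W j) := fun j => (hA j).basicOpen _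
  have hWV : ∀ j, W j ≤ (𝔸(J ⊕ Σ j, ↥(s j); S) ↘ S) ⁻¹ᵁ (V j : S.Opens) := fun j =>
    (𝔸(J ⊕ Σ j, ↥(s j); S)).basicOpen_le _
  -- `i⁻¹(W j) = D(f j)`
  have hiW : ∀ j, i ⁻¹ᵁ W j = X.basicOpen (f j) := fun j => by
    show i ⁻¹ᵁ (𝔸(J ⊕ Σ j, ↥(s j); S)).basicOpen (c j) = X.basicOpen (f j)
    rw [Scheme.preimage_basicOpen]
    have e : i.app _ (c j) = X.presheaf.map (homOfLE le_top).op (f j) := by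
      show (((𝔸(J ⊕ Σ j, ↥(s j); S)).presheaf.map (homOfLE le_top).op) ≫ i.app _) _ = _
      rw [i.naturality, CommRingCat.comp_apply]
      change X.presheaf.map _ (i.appTop (AffineSpace.coord S (Sum.inl j))) = _
      rw [hiv, hv]
      rfl
    rw [e, Scheme.basicOpen_res, inf_eq_right]
    refine (hfV j).trans (le_of_eq ?_)
    rw [← hiπ, Scheme.Hom.comp_preimage]
  refine isImmersion_of_affine_cover i W hWa (fun j => by rw [hiW]; exact (isAffineOpen_top X).basicOpen _)
    (fun y ⟨x, hx⟩ => ?_) fun j => ?_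
  · -- the image of `i` lies in `⋃ W j`
    subst hx
    have hx : x ∈ (⊤ : X.Opens) := trivial
    rw [← hcov] at hx
    obtain ⟨j, hj⟩ := Opens.mem_iSup.mp hx
    refine Set.mem_iUnion.mpr ⟨j, ?_⟩
    show x ∈ i ⁻¹ᵁ W j
    rwa [hiW]
  · -- surjectivity of `Γ(W j) → Γ(D(f j)) = A[1/f j]`
    have hle : X.basicOpen (f j) ≤ i ⁻¹ᵁ W j := (hiW j).ge
    rw [Scheme.Hom.app_eq_appLE,
      Scheme.Hom.appLE_congr i le_rfl rfl (hiW j) (fun g => Function.Surjective g)]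
    -- the values of `ψ = i.appLE (W j) (D(f j))` on the coordinates
    have hψ : ∀ k, i.appLE (W j) (X.basicOpen (f j)) hle
        ((𝔸(J ⊕ Σ j, ↥(s j); S)).presheaf.map (homOfLE le_top).op (AffineSpace.coord S k)) =
          algebraMap Γ(X, ⊤) Γ(X, X.basicOpen (f j)) (v k) := fun k => by
      show (((𝔸(J ⊕ Σ j, ↥(s j); S)).presheaf.map (homOfLE le_top).op) ≫
        i.appLE (W j) (X.basicOpen (f j)) hle) _ = _
      rw [Scheme.Hom.map_appLE]
      change (i.app ⊤ ≫ X.presheaf.map _) _ = _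
      rw [CommRingCat.comp_apply]
      change X.presheaf.map _ (i.appTop (AffineSpace.coord S k)) = _
      rw [hiv]
      rfl
    -- the coordinate `x_j` is a unit on `W j ⊆ D(x_j)`
    have hu : IsUnit (((𝔸(J ⊕ Σ j, ↥(s j); S)).presheaf.map (homOfLE (le_top : W j ≤ ⊤)).op)
        (AffineSpace.coord S (Sum.inl j))) := by
      have h1 := RingedSpace.isUnit_res_basicOpen
        (𝔸(J ⊕ Σ j, ↥(s j); S)).toLocallyRingedSpace.toRingedSpace (c j)
      have h2 : ((𝔸(J ⊕ Σ j, ↥(s j); S)).presheaf.map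
          (homOfLE ((𝔸(J ⊕ Σ j, ↥(s j); S)).basicOpen_le (c j))).op) (c j) =
            ((𝔸(J ⊕ Σ j, ↥(s j); S)).presheaf.map (homOfLE (le_top : W j ≤ ⊤)).op)
              (AffineSpace.coord S (Sum.inl j)) := by
        change (((𝔸(J ⊕ Σ j, ↥(s j); S)).presheaf.map (homOfLE le_top).op) ≫
          (𝔸(J ⊕ Σ j, ↥(s j); S)).presheaf.map
            (homOfLE ((𝔸(J ⊕ Σ j, ↥(s j); S)).basicOpen_le (c j))).op)
              (AffineSpace.coord S (Sum.inl j)) = _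
        rw [← Functor.map_comp]
        rfl
      rw [← h2]
      exact h1
    have hψj : algebraMap Γ(X, ⊤) Γ(X, X.basicOpen (f j)) (f j) =
        i.appLE (W j) (X.basicOpen (f j)) hle
          (((𝔸(J ⊕ Σ j, ↥(s j); S)).presheaf.map (homOfLE (le_top : W j ≤ ⊤)).op)
            (AffineSpace.coord S (Sum.inl j))) := by
      rw [hψ, hv, Sum.elim_inl]
    refine surjective_of_generators (f j) (π.appLE (V j) (X.basicOpen (f j)) (hfV j)).hom
      (i.appLE (W j) (X.basicOpen (f j)) hle).hom (s j) (hs j) (fun r => ?_) (↑hu.unit⁻¹) ?_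
      (fun y hy => ⟨ex j y, ((𝔸(J ⊕ Σ j, ↥(s j); S)).presheaf.map (homOfLE le_top).op)
        (AffineSpace.coord S (Sum.inr ⟨j, y, hy⟩)), ?_⟩)
    · -- `𝒪(V j) → A[1/f j]` factors through `Γ(W j)`
      refine ⟨((𝔸(J ⊕ Σ j, ↥(s j); S) ↘ S).appLE (V j) (W j) (hWV j)) r, ?_⟩
      change (((𝔸(J ⊕ Σ j, ↥(s j); S) ↘ S).appLE (V j) (W j) (hWV j) ≫
        i.appLE (W j) (X.basicOpen (f j)) hle) r) = _
      rw [Scheme.Hom.appLE_comp_appLE, Scheme.Hom.appLE.congr_simp _ _ hiπ]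
    · -- `ψ (x_j⁻¹) · f j / 1 = 1`
      change (i.appLE (W j) (X.basicOpen (f j)) hle) (↑hu.unit⁻¹) * _ = 1
      rw [hψj, ← map_mul, IsUnit.val_inv_mul, map_one]
    · -- numerators
      change _ = (i.appLE (W j) (X.basicOpen (f j)) hle) _
      rw [hψ, hv, Sum.elim_inr]
      exact hnum j y

end AffineSource

end Literature.AlgebraicGeometry.Morphisms

end
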